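import Mathlib
import Summits.NavierStokesRegularity.NavierStokesRegularity.Theorems.EulerZoomLiouvillePowerGaugeEulerLiouvilleDriftClockDecay
import Summits.NavierStokesRegularity.NavierStokesRegularity.Theorems.EulerZoomLiouvillePowerGaugeEulerLiouvilleNeedleClockThresholdMember
import Summits.NavierStokesRegularity.NavierStokesRegularity.Theorems.EulerZoomLiouvillePowerGaugeEulerLiouvilleNeedleWaitingTimeMember
import Summits.NavierStokesRegularity.NavierStokesRegularity.Theorems.EulerZoomLiouvillePowerGaugeEulerLiouvilleNeedleClockPast
import Summits.NavierStokesRegularity.NavierStokesRegularity.Theorems.EulerZoomLiouvillePowerGaugeEulerLiouvilleCondenserMinimalType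
import Summits.NavierStokesRegularity.NavierStokesRegularity.Theorems.EulerZoomLiouvillePowerGaugeEulerLiouvilleSelfSimilarPastStrata
import HarnessLib

/-!
# «ANY INWARD DRIFT KILLS», V (members): the absolute inflow-band deficit with DECAYING FLOOR `a₀/‖y‖²` kills — centred and past-exact
# (crux `EulerZoomLiouville.PowerGaugeEulerLiouville` = stmt-NavierStokesRegularity-19832, THE ONE STATEMENT `stub_selfSimilarC2Needle`; binder `HasFastVorticalChannel` alt 7)

Route `EulerZoomLiouville` (NavierStokesRegularity), crux E, LEAD seat ns-typeII-p2 g13 (own brick).  By-name assembly of the class-free POWER clock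
`DriftClock.powerClock_of_decayingBandDeficit` (this seat, `…DriftClockDecay`) with the power-clock thresholds `NeedleRace.selfSimilar_ae_eq_zero_of_subcriticalClockC2`
(ns-ezl-w2 g3, `…NeedleClockThresholdMember`) / `…_past` (ns-ezl-w4 g4, `…NeedleClockPast`) over a classical pressure of the profile.
With `W y = γy + V y`, `γ = 1/(2+ρ)`, `ℛ(y) = ⟪y, W y⟫`, `a(y) = ‖W y‖² + γℛ(y) + ⟪y, DV(y)(W y)⟫`:

* **`Loc.selfSimilar_ae_eq_zero_of_decayingBandDeficitC2_profile`** — crux hypotheses (`0 < ρ ≤ ½`), exact self-similarity about the origin with a `C²` profile `V`, and,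
  for ONE pair `κb > 0`, `a₀ > 0`, every classical pressure `P′` and every level `h`, a radius beyond which every VORTICAL point of `{ℋ_{P′} > h}` in the ABSOLUTE
  inflow band `−κb ≤ ℛ(y) ≤ 0` (radial similarity velocity in `[−κb/‖y‖, 0]`) has `a(y) ≥ a₀/‖y‖²` ⇒ `u = 0` a.e. on the slab.  CONTAINS alternative 4
  (`…absBandDeficitC2_profile`, constant floor) and hence alternatives 1–3.
* **`Past.selfSimilar_ae_eq_zero_of_decayingBandDeficitC2_profile_past`** — the same for members exactly self-similar about `(T, x₀)` for `τ < T₁` only.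

For the skeleton (LEAD, v87): `HasFastVorticalChannel ρ V` alternative 7.  THE ONE STATEMENT's residue: for all `κb, a₀ > 0` the needle has, beyond every radius, vortical
Bernoulli-high points that are CIRCULAR TO ORDER `1/‖y‖` (`−κb ≤ ℛ ≤ 0`) and CENTRIPETALLY BALANCED TO ORDER `1/‖y‖²` (`a < a₀/‖y‖²`; h-free form:
`y·∇P′ > ‖W‖² + γ(1−γ)‖y‖² − a₀/‖y‖² − (1−2γ)κb`).
WHAT THIS IS NOT: not NS, not E — strata on the model lattice; DENT 0 on the registered stubs; 19832 OPEN; NS regularity is NOT proved.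
[folklore; ConstantinIgnatovaVicol2026Putative §3.4–§3.5]
-/
noncomputable section

-- flat `Theorems/<Route><Decl>…` files of one crux share the namespace of the crux (tree convention: `Summit.<S>.<S>.…`)
set_option linter.dupNamespace false

open Set Filter Topology Metric Function MeasureTheory
open scoped RealInnerProductSpace NNReal ENNReal

namespace Summit.NavierStokesRegularity.NavierStokesRegularity.Theorems.PowerGaugeEulerLiouville

open Literature.Analysis Literature.Analysis.FluidPDE

/-- **EXACTLY SELF-SIMILAR MEMBERS WHOSE `C²` PROFILE HAS AN ABSOLUTE INFLOW-BAND DEFICIT WITH DECAYING FLOOR ARE TRIVIAL** (see the module docstring;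
crux hypotheses verbatim, `0 < ρ ≤ ½`, exact self-similarity about the origin, `V ∈ C²`; ABSOLUTE band).  Proof = classical pressure ⇒
`DriftClock.powerClock_of_decayingBandDeficit` ⇒ `NeedleRace.selfSimilar_ae_eq_zero_of_subcriticalClockC2`. [folklore; ConstantinIgnatovaVicol2026Putative §3.4–§3.5] -/
theorem Loc.selfSimilar_ae_eq_zero_of_decayingBandDeficitC2_profile {ρ : ℝ} (hρ : 0 < ρ) (hρ1 : ρ ≤ 1 / 2)
    {u : ℝ → EuclideanSpace ℝ (Fin 3) → EuclideanSpace ℝ (Fin 3)} {p : ℝ → EuclideanSpace ℝ (Fin 3) → ℝ}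
    {H : ℝ → EuclideanSpace ℝ (Fin 3) → EuclideanSpace ℝ (Fin 3) →L[ℝ] EuclideanSpace ℝ (Fin 3)} {c : ℝ≥0}
    (hsw : IsSuitableWeakSolutionOn (slab (EuclideanSpace ℝ (Fin 3)) (Iio 0) isOpen_Iio) 0 0 u p)
    (hH : HasWeakSpatialGradientOn (slab (EuclideanSpace ℝ (Fin 3)) (Iio 0) isOpen_Iio) u H)
    (hgauge : ∀ a : ℝ, 0 < a →
      ENNReal.ofReal (a ^ (2 * ρ)) * cknA a (0 : ℝ × EuclideanSpace ℝ (Fin 3)) u +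
          ENNReal.ofReal (a ^ ρ) * cknE a (0 : ℝ × EuclideanSpace ℝ (Fin 3)) H +
        ENNReal.ofReal (a ^ (2 * ρ)) * cknD a (0 : ℝ × EuclideanSpace ℝ (Fin 3)) p ≤ (c : ℝ≥0∞))
    {V : EuclideanSpace ℝ (Fin 3) → EuclideanSpace ℝ (Fin 3)} {P : EuclideanSpace ℝ (Fin 3) → ℝ}
    (hu : ∀ τ : ℝ, τ < 0 → u τ = selfSimilarCollapse (1 / (2 + ρ)) 0 V τ)
    (hp : ∀ τ : ℝ, τ < 0 → p τ = selfSimilarCollapsePressure (1 / (2 + ρ)) 0 P τ)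
    (hV : ContDiff ℝ 2 V) {κb a₀ : ℝ} (hκb : 0 < κb) (ha₀ : 0 < a₀)
    (hB : ∀ P' : EuclideanSpace ℝ (Fin 3) → ℝ, IsSelfSimilarEulerProfile (1 / (2 + ρ)) 0 V P' →
      ∀ h : ℝ, ∃ R₀ : ℝ, ∀ y : EuclideanSpace ℝ (Fin 3), R₀ ≤ ‖y‖ →
        h < selfSimilarBernoulli (1 / (2 + ρ)) 0 V P' y → curl V y ≠ 0 →
          -κb ≤ ⟪y, selfSimilarTransport (1 / (2 + ρ)) 0 V y⟫ →
          ⟪y, selfSimilarTransport (1 / (2 + ρ)) 0 V y⟫ ≤ 0 →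
          a₀ / ‖y‖ ^ 2 ≤ ‖selfSimilarTransport (1 / (2 + ρ)) 0 V y‖ ^ 2 +
            (1 / (2 + ρ)) * ⟪y, selfSimilarTransport (1 / (2 + ρ)) 0 V y⟫ +
            ⟪y, fderiv ℝ V y (selfSimilarTransport (1 / (2 + ρ)) 0 V y)⟫) :
    uncurry u =ᵐ[volume.restrict (Iio (0 : ℝ) ×ˢ (univ : Set (EuclideanSpace ℝ (Fin 3))))] 0 := by
  have hρ1' : ρ < 1 := by linarith
  -- ### a classical pressure for the profile
  have hD : ∀ a : ℝ, 0 < a → ENNReal.ofReal (a ^ (2 * ρ)) *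
      cknD a (0 : ℝ × EuclideanSpace ℝ (Fin 3)) p ≤ (c : ℝ≥0∞) :=
    fun a ha => le_trans le_add_self (hgauge a ha)
  have hpm : AEStronglyMeasurable (uncurry p)
      (volume.restrict (Iio (0 : ℝ) ×ˢ (univ : Set (EuclideanSpace ℝ (Fin 3))))) := by
    have := hsw.distributional.2.2.1.aestronglyMeasurable
    simpa [slab] using this
  have hPm := aestronglyMeasurable_pressureProfile hpm hp
  have hDprof := profile_pressure_weight_of_gaugeD hρ hρ1' hpm hp hD
  have hP1 : LocallyIntegrable P volume :=
    EnergySaturation.locallyIntegrable_pressure_of_weight hρ1' hPm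
      (ENNReal.mul_ne_top ENNReal.ofReal_ne_top ENNReal.coe_ne_top) hDprof
  obtain ⟨P', hprof⟩ :=
    WeakToClassical.exists_isSelfSimilarEulerProfile_of_contDiff hsw.distributional hu hp hV hP1
  -- ### the deficit is a power residence clock
  have hclock := DriftClock.powerClock_of_decayingBandDeficit hρ hρ1 hprof hκb ha₀ (hB P' hprof)
  -- ### every power clock kills
  exact NeedleRace.selfSimilar_ae_eq_zero_of_subcriticalClockC2 hρ hρ1 hsw hH hgauge hu hp hV hclock

namespace Past

variable {ρ T T₁ : ℝ}
  {u : ℝ → EuclideanSpace ℝ (Fin 3) → EuclideanSpace ℝ (Fin 3)} {p : ℝ → EuclideanSpace ℝ (Fin 3) → ℝ}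
  {H : ℝ → EuclideanSpace ℝ (Fin 3) → EuclideanSpace ℝ (Fin 3) →L[ℝ] EuclideanSpace ℝ (Fin 3)} {c : ℝ≥0}
  {V : EuclideanSpace ℝ (Fin 3) → EuclideanSpace ℝ (Fin 3)} {P : EuclideanSpace ℝ (Fin 3) → ℝ}

/-- **PAST-EXACT MEMBER WHOSE `C²` PROFILE HAS AN ABSOLUTE INFLOW-BAND DEFICIT WITH DECAYING FLOOR IS TRIVIAL** (crux hypotheses verbatim, `0 < ρ ≤ ½`;
exact self-similarity about `(T, x₀)` for `τ < T₁`, `T₁ ≤ 0`, `T₁ ≤ T`; `V ∈ C²`; ABSOLUTE band, DECAYING floor).  Proof = `Past.exists_isSelfSimilarEulerProfile` ⇒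
`DriftClock.powerClock_of_decayingBandDeficit` ⇒ `NeedleRace.selfSimilar_ae_eq_zero_of_subcriticalClockC2_past`. [folklore; ConstantinIgnatovaVicol2026Putative §3.4–§3.5] -/
theorem selfSimilar_ae_eq_zero_of_decayingBandDeficitC2_profile_past (hρ : 0 < ρ) (hρh : ρ ≤ 1 / 2) (hT₁ : T₁ ≤ 0)
    (hTT₁ : T₁ ≤ T) (x₀ : EuclideanSpace ℝ (Fin 3))
    (hsw : IsSuitableWeakSolutionOn (slab (EuclideanSpace ℝ (Fin 3)) (Iio 0) isOpen_Iio) 0 0 u p)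
    (hH : HasWeakSpatialGradientOn (slab (EuclideanSpace ℝ (Fin 3)) (Iio 0) isOpen_Iio) u H)
    (hgauge : ∀ a : ℝ, 0 < a →
      ENNReal.ofReal (a ^ (2 * ρ)) * cknA a (0 : ℝ × EuclideanSpace ℝ (Fin 3)) u +
          ENNReal.ofReal (a ^ ρ) * cknE a (0 : ℝ × EuclideanSpace ℝ (Fin 3)) H +
        ENNReal.ofReal (a ^ (2 * ρ)) * cknD a (0 : ℝ × EuclideanSpace ℝ (Fin 3)) p ≤ (c : ℝ≥0∞))
    (hu : ∀ τ : ℝ, τ < T₁ → u τ = fun x => selfSimilarCollapse (1 / (2 + ρ)) T V τ (x - x₀))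
    (hp : ∀ τ : ℝ, τ < T₁ → p τ = fun x => selfSimilarCollapsePressure (1 / (2 + ρ)) T P τ (x - x₀))
    (hV : ContDiff ℝ 2 V) {κb a₀ : ℝ} (hκb : 0 < κb) (ha₀ : 0 < a₀)
    (hB : ∀ P' : EuclideanSpace ℝ (Fin 3) → ℝ, IsSelfSimilarEulerProfile (1 / (2 + ρ)) 0 V P' →
      ∀ h : ℝ, ∃ R₀ : ℝ, ∀ y : EuclideanSpace ℝ (Fin 3), R₀ ≤ ‖y‖ →
        h < selfSimilarBernoulli (1 / (2 + ρ)) 0 V P' y → curl V y ≠ 0 →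
          -κb ≤ ⟪y, selfSimilarTransport (1 / (2 + ρ)) 0 V y⟫ →
          ⟪y, selfSimilarTransport (1 / (2 + ρ)) 0 V y⟫ ≤ 0 →
          a₀ / ‖y‖ ^ 2 ≤ ‖selfSimilarTransport (1 / (2 + ρ)) 0 V y‖ ^ 2 +
            (1 / (2 + ρ)) * ⟪y, selfSimilarTransport (1 / (2 + ρ)) 0 V y⟫ +
            ⟪y, fderiv ℝ V y (selfSimilarTransport (1 / (2 + ρ)) 0 V y)⟫) :
    uncurry u =ᵐ[volume.restrict (Iio (0 : ℝ) ×ˢ (univ : Set (EuclideanSpace ℝ (Fin 3))))] 0 := by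
  -- ### a classical pressure for the profile (far-past extension)
  obtain ⟨P', hprof⟩ := exists_isSelfSimilarEulerProfile hρ hT₁ hTT₁ hsw.distributional hu hp hV
  -- ### the deficit is a power residence clock
  have hclock := DriftClock.powerClock_of_decayingBandDeficit hρ hρh hprof hκb ha₀ (hB P' hprof)
  -- ### every power clock kills (past twin)
  exact NeedleRace.selfSimilar_ae_eq_zero_of_subcriticalClockC2_past hρ hρh hT₁ hTT₁ x₀ hsw hH hgauge hu hp hV hclock

end Past

end Summit.NavierStokesRegularity.NavierStokesRegularity.Theorems.PowerGaugeEulerLiouville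

end
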